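import Summits.ValiantsHypothesis.ValiantsHypothesis.Theorems.KPlusLogSqLawRealStaticNormalForm
import Summits.ValiantsHypothesis.ValiantsHypothesis.Theorems.LacunarySymmetroidMatrixDescartesCensusFormatMonotone

/-!
# Route «KPlusLogSqLaw» — the real static normal form ON THE DIAGONAL: Conjecture B is one row sequence about
# monomial-entry symmetric matrices of size `2^s` with `s²` exponent classes

HONEST FRAMING.  Helper bookkeeping for the OPEN crux `WeakLifting` (stmt-ValiantsHypothesis-19561, route `KPlusLogSqLaw`, cell
`pub-symmetroid`; seat val-sym-lift-p4 g25, 2026-08-29), continuing `…KPlusLogSqLawRealStaticNormalForm` (Conjecture B ⟺ its STATIC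
SYMMETRIC restriction).  Nothing here asserts `WeakLifting`, `TropicalB`, Conjecture B, `MatrixDescartes` (stmt-ValiantsHypothesis-18050)
or anything about VP ≠ VNP; the census registers are untouched.

CONTENT (all proved; «static» = every entry position carries at most one exponent class, stated inline).
* `staticSymm_of_le_terms` — static symmetric rows are monotone in the number of terms (append zero coefficients: still static);
* `staticSymm_of_le_size` — and in the size, for `K ≥ 1` (pad with the ONE-CLASS diagonal block `X^{d 0}·1`: still static and symmetric,
  the determinant gets the factor `X^{n·d 0} ≠ 0`, which can only add roots; the census padding `(∑ l, X^{d l})·1` of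
  `Census.exists_pad` is not static and is not used);
* `staticSymm_of_diagonal` — the static symmetric rows at the diagonal formats `(2^s, s²)` with budget `2^(C·s²)` give the static symmetric
  rows at EVERY format `(n, K)` with budget `2^(6·C·(K + ⌊log₂ n⌋²))` (pad to `s = ⌊log₂ n⌋ + √K + 1`, as in `KPlusLogSqLaw.kPlusLogSqLaw_iff_diagonal`);
* `kPlusLogSqLaw_iff_staticSymmDiagonal` — **Conjecture B ⟺ `∃ C, ∀ s`, every STATIC SYMMETRIC real pencil of format `(2^s, s²)` has at most
  `2^(C·s²)` distinct real zeros of its determinant**: one sequence of statements about signed matching polynomials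
  `∑_σ sign σ · c_σ · X^{w(σ)}` of symmetric `s²`-slope-class assignment instances on `2^s` points.
[folklore] padding / monotonicity bookkeeping; the conjecture itself is the cell's (no citation exists).
-/

set_option linter.dupNamespace false
set_option autoImplicit false

namespace Summit.ValiantsHypothesis.ValiantsHypothesis.Theorems.KPlusLogSqLaw.RealStatic

open Summit.ValiantsHypothesis.ValiantsHypothesis.Theorems.LacunarySymmetroidMatrixDescartes (RealRootLawAt KPlusLogSqLaw)
open Summit.ValiantsHypothesis.ValiantsHypothesis.Theorems.LacunarySymmetroidMatrixDescartes.Census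
  (realRootLawAt_mono pencil_append_zero isSymm_append_zero card_roots_le_of_mul)
open Summit.ValiantsHypothesis.ValiantsHypothesis.Theorems.LacunarySymmetroidMatrixDescartes.TropicalCensus (realRootLawAt_zero)
open Summit.ValiantsHypothesis.ValiantsHypothesis.Theorems.LacunarySymmetroidMatrixDescartes (StubBlockSector.sum_smul_fromBlocks_map)
open scoped BigOperators Matrix
open Polynomial

/-! ## 1. Static symmetric rows are monotone in the format -/

/-- **terms**: static symmetric rows at `(n, K')` bound static symmetric rows at `(n, K)` for `K ≤ K'` (append zero coefficient
matrices — no entry gains a class). [folklore] -/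
theorem staticSymm_of_le_terms {n K K' B : ℕ} (hK : K ≤ K')
    (h : ∀ (d : Fin K' → ℕ) (E : Fin K' → Matrix (Fin n) (Fin n) ℝ), (∀ l, (E l).IsSymm) →
      (∀ x y (l₁ l₂ : Fin K'), E l₁ x y ≠ 0 → E l₂ x y ≠ 0 → l₁ = l₂) →
      (Matrix.det (∑ l, ((Polynomial.X : Polynomial ℝ) ^ d l) • (E l).map Polynomial.C)).roots.toFinset.card ≤ B) :
    ∀ (d : Fin K → ℕ) (E : Fin K → Matrix (Fin n) (Fin n) ℝ), (∀ l, (E l).IsSymm) →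
      (∀ x y (l₁ l₂ : Fin K), E l₁ x y ≠ 0 → E l₂ x y ≠ 0 → l₁ = l₂) →
      (Matrix.det (∑ l, ((Polynomial.X : Polynomial ℝ) ^ d l) • (E l).map Polynomial.C)).roots.toFinset.card ≤ B := by
  obtain ⟨j, rfl⟩ := Nat.exists_eq_add_of_le hK
  intro d E hsy hst
  have h1 := h (Fin.append d (fun _ : Fin j => 0)) (Fin.append E (fun _ : Fin j => 0)) (isSymm_append_zero E hsy) ?_
  · rwa [pencil_append_zero] at h1
  · intro x y l₁ l₂ h₁ h₂
    induction l₁ using Fin.addCases with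
    | left a =>
      induction l₂ using Fin.addCases with
      | left b =>
        rw [Fin.append_left] at h₁ h₂
        rw [hst x y a b h₁ h₂]
      | right b => rw [Fin.append_right] at h₂; exact absurd rfl h₂
    | right a => rw [Fin.append_right] at h₁; exact absurd rfl h₁

/-- one-class diagonal padding: `∑ l, X^{d l} • [[E l, 0], [0, [l = l₀]·1]] = [[pencil, 0], [0, X^{d l₀}·1]]`, so the determinant
gets the factor `(X^{d l₀})^n`. [folklore] -/
theorem det_pencil_padClass {m n K : ℕ} (d : Fin K → ℕ) (E : Fin K → Matrix (Fin m) (Fin m) ℝ) (l₀ : Fin K) :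
    Matrix.det (∑ l, ((Polynomial.X : Polynomial ℝ) ^ d l) •
        (Matrix.reindex finSumFinEquiv finSumFinEquiv
          (Matrix.fromBlocks (E l) 0 0 (if l = l₀ then (1 : Matrix (Fin n) (Fin n) ℝ) else 0))).map Polynomial.C)
      = Matrix.det (∑ l, ((Polynomial.X : Polynomial ℝ) ^ d l) • (E l).map Polynomial.C) *
          ((Polynomial.X : Polynomial ℝ) ^ d l₀) ^ n := by
  have h1 : (∑ l, ((Polynomial.X : Polynomial ℝ) ^ d l) •
        (Matrix.reindex finSumFinEquiv finSumFinEquiv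
          (Matrix.fromBlocks (E l) 0 0 (if l = l₀ then (1 : Matrix (Fin n) (Fin n) ℝ) else 0))).map Polynomial.C)
      = Matrix.reindex finSumFinEquiv finSumFinEquiv
          (∑ l, ((Polynomial.X : Polynomial ℝ) ^ d l) •
            (Matrix.fromBlocks (E l) 0 0 (if l = l₀ then (1 : Matrix (Fin n) (Fin n) ℝ) else 0)).map Polynomial.C) := by
    ext i j
    simp only [Matrix.reindex_apply, Matrix.submatrix_apply, Matrix.sum_apply, Matrix.smul_apply, Matrix.map_apply]
  have h2 : (∑ l, ((Polynomial.X : Polynomial ℝ) ^ d l) •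
        ((if l = l₀ then (1 : Matrix (Fin n) (Fin n) ℝ) else 0).map Polynomial.C))
      = ((Polynomial.X : Polynomial ℝ) ^ d l₀) • (1 : Matrix (Fin n) (Fin n) (Polynomial ℝ)) := by
    rw [Finset.sum_eq_single l₀]
    · rw [if_pos rfl, Matrix.map_one Polynomial.C (map_zero _) (map_one _)]
    · intro l _ hl
      rw [if_neg hl, Matrix.map_zero _ (map_zero _), smul_zero]
    · intro h; exact absurd (Finset.mem_univ l₀) h
  rw [h1, Matrix.det_reindex_self, StubBlockSector.sum_smul_fromBlocks_map, Matrix.det_fromBlocks_zero₂₁, h2,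
    Matrix.det_smul, Matrix.det_one, mul_one, Fintype.card_fin]

/-- **size**: static symmetric rows at `(m', K)` bound static symmetric rows at `(m, K)` for `m ≤ m'` and `K ≥ 1` (one-class diagonal
padding). [folklore] -/
theorem staticSymm_of_le_size {m m' K B : ℕ} (hK : 0 < K) (hm : m ≤ m')
    (h : ∀ (d : Fin K → ℕ) (E : Fin K → Matrix (Fin m') (Fin m') ℝ), (∀ l, (E l).IsSymm) →
      (∀ x y (l₁ l₂ : Fin K), E l₁ x y ≠ 0 → E l₂ x y ≠ 0 → l₁ = l₂) →
      (Matrix.det (∑ l, ((Polynomial.X : Polynomial ℝ) ^ d l) • (E l).map Polynomial.C)).roots.toFinset.card ≤ B) :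
    ∀ (d : Fin K → ℕ) (E : Fin K → Matrix (Fin m) (Fin m) ℝ), (∀ l, (E l).IsSymm) →
      (∀ x y (l₁ l₂ : Fin K), E l₁ x y ≠ 0 → E l₂ x y ≠ 0 → l₁ = l₂) →
      (Matrix.det (∑ l, ((Polynomial.X : Polynomial ℝ) ^ d l) • (E l).map Polynomial.C)).roots.toFinset.card ≤ B := by
  obtain ⟨n, rfl⟩ := Nat.exists_eq_add_of_le hm
  intro d E hsy hst
  set l₀ : Fin K := ⟨0, hK⟩ with hl₀
  let E' : Fin K → Matrix (Fin (m + n)) (Fin (m + n)) ℝ := fun l =>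
    Matrix.reindex finSumFinEquiv finSumFinEquiv
      (Matrix.fromBlocks (E l) 0 0 (if l = l₀ then (1 : Matrix (Fin n) (Fin n) ℝ) else 0))
  have hsy' : ∀ l, (E' l).IsSymm := by
    intro l
    refine (Matrix.IsSymm.fromBlocks (hsy l) (by simp) ?_).submatrix _
    by_cases hl : l = l₀
    · rw [if_pos hl]; exact Matrix.isSymm_one
    · rw [if_neg hl]; exact Matrix.isSymm_zero
  have hst' : ∀ x y (l₁ l₂ : Fin K), E' l₁ x y ≠ 0 → E' l₂ x y ≠ 0 → l₁ = l₂ := by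
    intro x y l₁ l₂ h₁ h₂
    simp only [E', Matrix.reindex_apply, Matrix.submatrix_apply] at h₁ h₂
    rcases hx : finSumFinEquiv.symm x with i | i <;> rcases hy : finSumFinEquiv.symm y with j | j <;>
      rw [hx, hy] at h₁ h₂
    · simp only [Matrix.fromBlocks_apply₁₁] at h₁ h₂
      exact hst i j l₁ l₂ h₁ h₂
    · simp at h₁
    · simp at h₁
    · simp only [Matrix.fromBlocks_apply₂₂] at h₁ h₂
      by_cases c₁ : l₁ = l₀
      · by_cases c₂ : l₂ = l₀
        · rw [c₁, c₂]
        · rw [if_neg c₂] at h₂; exact absurd rfl h₂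
      · rw [if_neg c₁] at h₁; exact absurd rfl h₁
  have hbig := h d E' hsy' hst'
  have hdet : Matrix.det (∑ l, ((Polynomial.X : Polynomial ℝ) ^ d l) • (E' l).map Polynomial.C)
      = Matrix.det (∑ l, ((Polynomial.X : Polynomial ℝ) ^ d l) • (E l).map Polynomial.C) *
          ((Polynomial.X : Polynomial ℝ) ^ d l₀) ^ n := det_pencil_padClass d E l₀
  rw [hdet] at hbig
  exact ((card_roots_le_of_mul _ _ (pow_ne_zero _ (pow_ne_zero _ Polynomial.X_ne_zero))).1).trans hbig

/-! ## 2. The diagonal formats carry the static symmetric statement, hence Conjecture B -/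

/-- **diagonal ⟹ everywhere for static symmetric rows**: budget `2^(C·s²)` at the formats `(2^s, s²)` gives budget
`2^(6·C·(K + ⌊log₂ n⌋²))` at every format (`s = ⌊log₂ n⌋ + √K + 1`, `s² ≤ 6(K + ⌊log₂ n⌋²)`). [folklore] -/
theorem staticSymm_of_diagonal {C : ℕ}
    (h : ∀ (s : ℕ) (d : Fin (s ^ 2) → ℕ) (E : Fin (s ^ 2) → Matrix (Fin (2 ^ s)) (Fin (2 ^ s)) ℝ), (∀ l, (E l).IsSymm) →
      (∀ x y (l₁ l₂ : Fin (s ^ 2)), E l₁ x y ≠ 0 → E l₂ x y ≠ 0 → l₁ = l₂) →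
      (Matrix.det (∑ l, ((Polynomial.X : Polynomial ℝ) ^ d l) • (E l).map Polynomial.C)).roots.toFinset.card ≤ 2 ^ (C * s ^ 2))
    (n K : ℕ) (d : Fin K → ℕ) (E : Fin K → Matrix (Fin n) (Fin n) ℝ) (hsy : ∀ l, (E l).IsSymm)
    (hst : ∀ x y (l₁ l₂ : Fin K), E l₁ x y ≠ 0 → E l₂ x y ≠ 0 → l₁ = l₂) :
    (Matrix.det (∑ l, ((Polynomial.X : Polynomial ℝ) ^ d l) • (E l).map Polynomial.C)).roots.toFinset.card
      ≤ 2 ^ (6 * C * (K + Nat.log 2 n ^ 2)) := by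
  rcases Nat.eq_zero_or_pos K with rfl | hK0
  · exact (realRootLawAt_zero n _ d E hsy)
  set L := Nat.log 2 n with hL
  set s := L + Nat.sqrt K + 1 with hs
  have hn : n ≤ 2 ^ s :=
    (Nat.lt_pow_succ_log_self one_lt_two n).le.trans (Nat.pow_le_pow_right two_pos (by omega))
  have hK : K ≤ s ^ 2 := (Nat.lt_succ_sqrt' K).le.trans (Nat.pow_le_pow_left (by omega) 2)
  have h1 : (Matrix.det (∑ l, ((Polynomial.X : Polynomial ℝ) ^ d l) • (E l).map Polynomial.C)).roots.toFinset.card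
      ≤ 2 ^ (C * s ^ 2) :=
    staticSymm_of_le_size hK0 hn (staticSymm_of_le_terms hK (h s)) d E hsy hst
  refine h1.trans (Nat.pow_le_pow_right two_pos ?_)
  have h2 : Nat.sqrt K ^ 2 ≤ K := Nat.sqrt_le' K
  have h3 : s ^ 2 ≤ 3 * (L ^ 2 + Nat.sqrt K ^ 2 + 1) := by
    rw [hs]; nlinarith [sq_nonneg ((L : ℤ) - Nat.sqrt K), sq_nonneg ((L : ℤ) - 1), sq_nonneg ((Nat.sqrt K : ℤ) - 1)]
  nlinarith

/-- **Conjecture B ⟺ its STATIC SYMMETRIC DIAGONAL** — `KPlusLogSqLaw ↔ ∃ C, ∀ s`, every static symmetric real pencil of format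
`(2^s, s²)` has at most `2^(C·s²)` distinct real zeros of its determinant.  An EQUIVALENCE between OPEN statements (both sides
unasserted): Conjecture B is one sequence of statements about signed matching polynomials of symmetric `s²`-slope-class
assignment instances on `2^s` points. [folklore] -/
theorem kPlusLogSqLaw_iff_staticSymmDiagonal :
    KPlusLogSqLaw ↔ ∃ C : ℕ, ∀ (s : ℕ) (d : Fin (s ^ 2) → ℕ) (E : Fin (s ^ 2) → Matrix (Fin (2 ^ s)) (Fin (2 ^ s)) ℝ),
      (∀ l, (E l).IsSymm) → (∀ x y (l₁ l₂ : Fin (s ^ 2)), E l₁ x y ≠ 0 → E l₂ x y ≠ 0 → l₁ = l₂) →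
      (Matrix.det (∑ l, ((Polynomial.X : Polynomial ℝ) ^ d l) • (E l).map Polynomial.C)).roots.toFinset.card
        ≤ 2 ^ (C * s ^ 2) := by
  rw [kPlusLogSqLaw_iff_staticSymm]
  constructor
  · rintro ⟨C, hC⟩
    refine ⟨2 * C, fun s d E hsy hst => (hC (2 ^ s) (s ^ 2) d E hsy hst).trans (Nat.pow_le_pow_right two_pos ?_)⟩
    rw [Nat.log_pow one_lt_two]
    nlinarith
  · rintro ⟨C, hC⟩
    exact ⟨6 * C, fun n K' d E hsy hst => staticSymm_of_diagonal hC n K' d E hsy hst⟩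

end Summit.ValiantsHypothesis.ValiantsHypothesis.Theorems.KPlusLogSqLaw.RealStatic
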